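import Summits.QuantumFields.YangMills.Theorems.BalabanUVNodesN22KernelsBetaHistLipschitz
import Summits.QuantumFields.YangMills.Theorems.BalabanUVNodesN17HistModuliContRecord13
import Summits.QuantumFields.YangMills.Theorems.BalabanUVNodesK2Line2FirstRungsAtScaleZero

/-!
# BalabanUVNodes ∕ N18 — THE FACE `g_k → 0⁺` OF THE NODE-U3 → U2 EDGE: the (2.12) existence clause `Node00.Beta0LimitExists`
# (the one-sided limit of the merged β in the LAST coupling) IS NOT AN EXTRA LETTER — it follows from node U2's history moduli
# `HistLipschitz`, hence from N22's kernel NE9 + (D4)'s (5.10) clause, with the RATE at the face `|β_m − β⁰| ≤ Λ_last · g`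
# (Track A, DAG node N18 = NE5, cluster K4 «SpineRates»; key K3⁷ `SpineGivenEndpointR13SepCoPH`, skeleton v5 941dddb108cbaacf)

Cell `pub-ymgap` (HUMAN RULING D-0062, Track A full width), WIDTH SEAT `pub-ymgap-dag-n18-w1` generation 3 (harness re-seat; START-LIST v10 §0 (iii):
the §n18 item-1 list is by-name exhausted, this is the successor sub-lemma the seat named on the bus, CLAIM-1 ∕ INTENT-1 I.28982).  THEOREMS ONLY
(0 `def`, 0 `instance`, 0 `notation`, 0 `sorry`; standard axioms); filed `--kind proof --supports stmt-QuantumFields-20544 --as helper`.  COUNT-NEUTRAL.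

HONEST FRAMING (binding).  A LOCATED junction: ONE lemma of real analysis (a function Lipschitz on `]0, γ]` has a limit at `0⁺` — McShane extension
`LipschitzOnWith.extend_real` + continuity; the rate by `le_of_tendsto_of_tendsto`) composed BY NAME with LANDED producers of node U2's history moduli:
dag-n22-w3's `YMDAG.N22.AtKernels.histLipschitz_betaMerged_of_ne9` (kernel NE9 + one (5.10) clause ⇒ `HistLipschitz` of the merged β) and dag-n17-w3's
`YMDAG.N17.HistModuliCont.histLipschitz_of_readOutAt_n22` ((D4) ∧ N22 at node U3's carriers ⇒ `HistLipschitz` of the datum's β).  The kernel letters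
(NE9 ∕ (5.10) of the merged term of record — NOT PRINTED for d = 4 ∕ a tree road with undischarged leaves) STAY DISPLAYED HYPOTHESES, exactly as K3⁷ v5
§2b (i) ∕ (iii) displays them; the admissibility of the reference histories `θ.v₀` is displayed as in every consumer (`hadm`).  Nothing of Bałaban's is
asserted or instantiated; N17 ∕ N18 ∕ N22 are NOT discharged; K3⁷ is OPEN (`stub_rates13H` ∕ `stub_expansion13H` NOT proved); K2⁷ NOT claimed; counts
UNMOVED (typed 28∕28 · discharged 5∕27 (A 5∕28); the chair's single count line is the only count).  One finite four-torus programme at fixed ε —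
R4 closes the CONDITIONAL rung `BalabanLadder.UV` only; NOTHING about the continuum limit, ℝ⁴, OS axioms, infinite volume or the Yang–Mills mass gap
(Clay) is proved or claimed by any of this.

WHY.  def-B's `Node00.Beta0LimitExists β_m v₀` (chair R434 (c3): «the existence of the limit a NAMED Prop … an explicit hypothesis binder of any crux
that needs β to BE the limit») is [I] p. 264 ∕ (2.12)–(2.14) p. 268 («the remainder vanishes at `g_k = 0`») read as the one-sided limit of the merged
β in its LAST coupling at a reference history `v₀ k`; the β of record READS it (`betaOfRecord₁₃ = betaOfMerged β_m (beta0OfMerged β_m θ.v₀) θ.γ`).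
It is DISPLAYED as `hlim` by every N17 ∕ N13 ∕ N28 consumer at the Stage-13 record (`…N17AtRecord13Sep.content_of_N17_datumOfRecord₁₃Sep`,
`…N17AtRecord13CoP`, `…SepKeys`, `…Keys`, `…N13WindowAtRecord13SepCoPH.window_…`, `…N28AtRecord11`) and IS K2⁷ line 2's `k = 0` rung S2
(`…K2Line2FirstRungsAtScaleZero.anchorZero_iff_beta0LimitExists_zero`); no file of the tree concluded it (census 2026-08-28T04:58Z).  But node U2's SECOND
input `HistLipschitz Λ γ β` (joint history-Lipschitz on the boxes `]0, γ]^{k+1}`) makes `g ↦ β k (update (v₀ k) last g)` Lipschitz on `]0, γ]` with constant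
`Λ k last` whenever `v₀ k` is admissible — so the face limit EXISTS (ℝ is complete), at rate `Λ k last · g`; and `HistLipschitz` of the merged β is PRODUCED
in the tree from N22's kernel NE9 + the (5.10) clause (dag-n22-w3) or from `ReadOutAt D u ∧ N22At u` (dag-n17-w3).  N18's own slot (NE5) is IDLE here — the
mirror of dag-n17-w3's «(D4) ∧ N22 ⇒ `BetaContH`, N18 idle»; this seat's g2 stopped exactly before this face (I.26136).

WHAT (theorems only).
* §1 `exists_tendsto_nhdsGT_zero_of_lipschitzOnWith_Ioc` — pure: `f` Lipschitz (`K`) on `Ioc 0 γ`, `0 < γ` ⟹ `∃ b, Tendsto f (𝓝[>] 0) (𝓝 b) ∧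
  ∀ x ∈ Ioc 0 γ, |f x − b| ≤ K·x`.
* §2 node U2 currency (ANY `HBeta`): `update_last_mem_box`, `abs_sub_update_last_le_of_histLipschitz`, `lipschitzOnWith_update_last_of_histLipschitz`,
  ★ `beta0LimitExists_of_histLipschitz`, ★ `abs_sub_beta0OfMerged_le_of_histLipschitz` (the RATE AT THE FACE), `beta0OfMerged_congr_box` ∕
  `beta0LimitExists_congr_box` (two families agreeing on the boxes carry the same one-loop numbers and the same clause), `beta0LimitExists_betaOfMerged_iff`.
* §3 generic term family (def-W1's `U3OfKernels` objects): ★ `beta0LimitExists_betaMerged_of_ne9` (`0 < κ`, `NE9 (EA F ℰ ρ bV) (Window γ) κ Λ`,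
  `KernelDecay F ℰ ρ bV (Window γ) 0 1 κ`, admissible `v₀`), `abs_betaMerged_sub_beta0OfMerged_le_of_ne9` (rate `betaPrime510 4 1 κ · Λ (k+1) k · g`).
* §4 AT THE RECORD, Stage 13: ★★ `beta0LimitExists_betaMerged_record_of_kernelNE9` — conclusion VERBATIM the consumers' `hlim` (`TβOfRecord₁₃ = TcanOfRecord`,
  `chiβOfRecord₁₃ θ = chiFixed29 … θ.ν θ.ε₂₉` are `abbrev`s) from the SAME two raw inputs K3⁷ v5 §2b (i)∕(iii) display + `hadm`; letter-block edition
  `…_of_kernelNE9_letters` (`ℓ.Signs`, rate `betaPrime510 4 1 ℓ.κ · ℓ.C₉ · ℓ.ω · g`, UNIFORM in `k`).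
* §5 K3⁷ ∕ K4 currency: ★★ `beta0LimitExists_βfun_of_readOutAt_n22` (`ReadOutAt D u ∧ N22At u` at ANY node-U3 carriers ⟹ the clause for `D.βfun`),
  `…_of_readOutAt_ne9`, the face rate `u.cr · u.Λ (k+1) k · g`, and ★★ `beta0LimitExists_betaMerged_of_readOutAt_n22_rateCarriersOfRecord₁₃CoPH` — at the
  bundle of record of ANY Stage-13 rate reading `𝔯` (K3⁷ v5's `rrOfRecord 𝔯 ksel` at one tuple and run length): the N22 and (D4) conjuncts of `PHolderD4`
  ALREADY give the consumers' `hlim` for the merged β of record.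
* §6 SERVED BY NAME (not claimed): `window_datumOfRecord₁₃SepCoPH_of_kernelNE9` — the `K ≥ 1` WINDOW at the Sep datum (K1⁷ rung 2's last conjunct ∕ K2⁷'s
  window hypothesis; dag-n13-w4's `…N13WindowAtRecord13SepCoPH.window_datumOfRecord₁₃SepCoPH_of_beta0LimitExists`) and `anchorZero_of_kernelNE9` — K2⁷ line 2's
  `k = 0` rung S2 (dag-n13-w4's `…K2Line2FirstRungsAtScaleZero.anchorZero_of_beta0LimitExists`), both from the same two kernel inputs + `hadm`.

References (TYPES ∕ locators only): [I] = [Balaban1987RG1] T. Bałaban, Commun. Math. Phys. **109** (1987) 249–301: (1.20)–(1.22) p. 264, (2.12)–(2.14)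
p. 268, §5 p. 298, (5.10) p. 293.  McShane extension: E. J. McShane, Bull. AMS 40 (1934) (Mathlib `LipschitzOnWith.extend_real`).
-/

noncomputable section

open Filter Topology
open scoped BigOperators NNReal

namespace YMDAG.N18.Beta0LimitOfKernelLetters

open Literature.MathematicalPhysics.QuantumFieldTheory.Balaban1983to89
open Literature.MathematicalPhysics.QuantumFieldTheory.Balaban1983to89.T4Continuum (T4Family ULoop)
open Literature.MathematicalPhysics.QuantumFieldTheory.Balaban1983to89.T4OutputRate (Window NE9)
open Literature.MathematicalPhysics.QuantumFieldTheory.Balaban1983to89.FlowStep (Box HBeta mem_box)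
open Literature.MathematicalPhysics.QuantumFieldTheory.Balaban1983to89.T4CouplingMatching (HistLipschitz)
open Literature.MathematicalPhysics.QuantumFieldTheory.Balaban1983to89.Node00 (TermFamily1 betaMerged betaOfMerged beta0OfMerged Beta0LimitExists
  tendsto_beta0OfMerged betaOfMerged_of_mem mergedTermFamilyMatT TβOfRecord₁₃ TcanOfRecord chiβOfRecord₁₃ betaOfRecord₁₃ Stage13Params Stage13HParams
  U3Letters₁₁ datumOfRecord₁₃CoPH)
open Literature.MathematicalPhysics.QuantumFieldTheory.Balaban1983to89.Node00.U3OfKernels (EA objectsOfRecord₁₃ KernelDecay KernelDecayOfRecord₁₃)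
open Literature.MathematicalPhysics.QuantumFieldTheory.Balaban1983to89.B12Sec2to5 (betaPrime510)
open YMDAG.UVSplit (U3Carriers N22At ReadOutAt Datum RateReading₁₃CoPH rateCarriersOfRecord₁₃CoPH u3OfRecord₁₃)
open YMDAG.N22.AtKernels (histLipschitz_betaMerged_of_ne9)
open YMDAG.N17.HistModuliCont (histLipschitz_of_readOutAt_ne9 histLipschitz_of_readOutAt_n22)

/-! ## §1 Real analysis: a function Lipschitz on `]0, γ]` has a limit at `0⁺`, at a linear rate -/

/-- **LIPSCHITZ ON `]0, γ]` ⇒ THE ONE-SIDED LIMIT AT `0` EXISTS, WITH RATE `K·x`.**  McShane's extension (`LipschitzOnWith.extend_real`) gives a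
`K`-Lipschitz `g : ℝ → ℝ` agreeing with `f` on `]0, γ]`; `g` is continuous, so `f → g 0` along `𝓝[>] 0` (the two agree on `Ioc 0 γ ∈ 𝓝[>] 0`), and
`|f x − g 0| = |g x − g 0| ≤ K·|x|`. [folklore] -/
theorem exists_tendsto_nhdsGT_zero_of_lipschitzOnWith_Ioc {f : ℝ → ℝ} {K : ℝ≥0} {γ : ℝ} (hγ : 0 < γ)
    (hf : LipschitzOnWith K f (Set.Ioc 0 γ)) :
    ∃ b : ℝ, Tendsto f (𝓝[>] (0 : ℝ)) (𝓝 b) ∧ ∀ x ∈ Set.Ioc 0 γ, |f x - b| ≤ K * x := by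
  obtain ⟨g, hg, hfg⟩ := hf.extend_real
  refine ⟨g 0, ?_, fun x hx => ?_⟩
  · have h1 : Tendsto g (𝓝[>] (0 : ℝ)) (𝓝 (g 0)) := (hg.continuous.tendsto 0).mono_left nhdsWithin_le_nhds
    refine h1.congr' ?_
    filter_upwards [Ioc_mem_nhdsGT hγ] with x hx
    exact (hfg hx).symm
  · have h := hg.dist_le_mul x 0
    rw [Real.dist_eq, Real.dist_eq, sub_zero, abs_of_pos hx.1] at h
    rw [hfg hx]
    exact h

/-! ## §2 Node U2 currency: `HistLipschitz` ⇒ `Beta0LimitExists` at admissible reference histories, with the rate at the face -/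

section U2

variable {β : HBeta} {Λ : ℕ → ℕ → ℝ} {γ : ℝ}

/-- Updating the LAST entry of a box history by a member of `]0, γ]` stays in the box. [folklore] -/
theorem update_last_mem_box {k : ℕ} {v : Fin (k + 1) → ℝ} (hv : v ∈ Box γ k) {g : ℝ} (hg : g ∈ Set.Ioc 0 γ) :
    Function.update v (Fin.last k) g ∈ Box γ k := by
  rw [mem_box] at hv ⊢
  intro i
  by_cases hi : i = Fin.last k
  · subst hi
    rw [Function.update_self]
    exact hg
  · rw [Function.update_of_ne hi]
    exact hv i

/-- **`HistLipschitz` IN THE LAST COUPLING**: at an admissible history, two updates of the last entry inside `]0, γ]` change `β k` by at most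
`Λ k last · |g − g'|` (every other coordinate of the modulus sum vanishes). [cite: Balaban1987RG1, §5 p.298 (the moduli are binders; bookkeeping)] -/
theorem abs_sub_update_last_le_of_histLipschitz (hL : HistLipschitz Λ γ β) {k : ℕ} {v : Fin (k + 1) → ℝ} (hv : v ∈ Box γ k)
    {g g' : ℝ} (hg : g ∈ Set.Ioc 0 γ) (hg' : g' ∈ Set.Ioc 0 γ) :
    |β k (Function.update v (Fin.last k) g) - β k (Function.update v (Fin.last k) g')| ≤ Λ k (Fin.last k) * |g - g'| := by
  have h := hL k _ _ (update_last_mem_box hv hg) (update_last_mem_box hv hg')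
  rw [Finset.sum_eq_single (Fin.last k) (fun i _ hi => by
      rw [Function.update_of_ne hi, Function.update_of_ne hi, sub_self, abs_zero, mul_zero])
    (fun hnot => absurd (Finset.mem_univ _) hnot), Function.update_self, Function.update_self] at h
  exact h

/-- The last-coupling section `g ↦ β k (update v last g)` of a history-Lipschitz family at an admissible history is Lipschitz on `]0, γ]`
with constant `(Λ k last)⁺`. [folklore] -/
theorem lipschitzOnWith_update_last_of_histLipschitz (hL : HistLipschitz Λ γ β) {k : ℕ} {v : Fin (k + 1) → ℝ} (hv : v ∈ Box γ k) :
    LipschitzOnWith (Real.toNNReal (Λ k (Fin.last k))) (fun g : ℝ => β k (Function.update v (Fin.last k) g)) (Set.Ioc 0 γ) :=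
  LipschitzOnWith.of_dist_le_mul fun x hx y hy => by
    rw [Real.dist_eq, Real.dist_eq]
    exact (abs_sub_update_last_le_of_histLipschitz hL hv hx hy).trans
      (mul_le_mul_of_nonneg_right (Real.le_coe_toNNReal _) (abs_nonneg _))

/-- ★ **THE (2.12) EXISTENCE CLAUSE FROM NODE U2's HISTORY MODULI.**  If `β` is history-Lipschitz on the boxes `]0, γ]^{k+1}` (any moduli `Λ`) and the
reference histories `v₀ k` are admissible (entries in `]0, γ]`), then for every `k` the one-sided limit of `g ↦ β k (update (v₀ k) last g)` as `g → 0⁺`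
EXISTS: `Node00.Beta0LimitExists β v₀`.  (ℝ is complete; §1.)  The moduli themselves are UNPRINTED binders ([I] p. 298 says only that the dependence exists).
[cite: Balaban1987RG1, (2.12)-(2.14) p.268 and §5 p.298] -/
theorem beta0LimitExists_of_histLipschitz (hL : HistLipschitz Λ γ β) {v₀ : (k : ℕ) → (Fin (k + 1) → ℝ)}
    (hv₀ : ∀ k i, 0 < v₀ k i ∧ v₀ k i ≤ γ) : Beta0LimitExists β v₀ := by
  intro k
  have hγ : 0 < γ := (hv₀ k (Fin.last k)).1.trans_le (hv₀ k (Fin.last k)).2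
  obtain ⟨b, hb, -⟩ := exists_tendsto_nhdsGT_zero_of_lipschitzOnWith_Ioc hγ
    (lipschitzOnWith_update_last_of_histLipschitz hL (mem_box.2 (hv₀ k)))
  exact ⟨b, hb⟩

/-- ★ **THE RATE AT THE FACE**: under the same hypotheses, for every `g ∈ ]0, γ]`,
`|β k (update (v₀ k) last g) − beta0OfMerged β v₀ k| ≤ Λ k last · g` — the one-loop number `β⁰_{k+1} := lim_{g→0⁺}` is approached LINEARLY in the last
coupling («β¹ = O(g_k)»; print's remainder (2.13) «vanishes at g_k = 0», p. 268).  Proof: `|β(…g) − β(…g')| ≤ Λ|g − g'|` for `g' ∈ ]0, γ]`, let `g' → 0⁺`.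
[cite: Balaban1987RG1, (2.12)-(2.14) p.268 and §5 p.298] -/
theorem abs_sub_beta0OfMerged_le_of_histLipschitz (hL : HistLipschitz Λ γ β) {v₀ : (k : ℕ) → (Fin (k + 1) → ℝ)}
    (hv₀ : ∀ k i, 0 < v₀ k i ∧ v₀ k i ≤ γ) (k : ℕ) {g : ℝ} (hg : g ∈ Set.Ioc 0 γ) :
    |β k (Function.update (v₀ k) (Fin.last k) g) - beta0OfMerged β v₀ k| ≤ Λ k (Fin.last k) * g := by
  have hγ : 0 < γ := hg.1.trans_le hg.2
  have ht := tendsto_beta0OfMerged β v₀ (beta0LimitExists_of_histLipschitz hL hv₀) k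
  have hev : ∀ᶠ g' in 𝓝[>] (0 : ℝ), |β k (Function.update (v₀ k) (Fin.last k) g) - β k (Function.update (v₀ k) (Fin.last k) g')| ≤
      Λ k (Fin.last k) * |g - g'| := by
    filter_upwards [Ioc_mem_nhdsGT hγ] with g' hg'
    exact abs_sub_update_last_le_of_histLipschitz hL (mem_box.2 (hv₀ k)) hg hg'
  have h1 : Tendsto (fun g' : ℝ => |β k (Function.update (v₀ k) (Fin.last k) g) - β k (Function.update (v₀ k) (Fin.last k) g')|)
      (𝓝[>] (0 : ℝ)) (𝓝 |β k (Function.update (v₀ k) (Fin.last k) g) - beta0OfMerged β v₀ k|) :=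
    (tendsto_const_nhds.sub ht).abs
  have h0 : Tendsto (fun g' : ℝ => g') (𝓝[>] (0 : ℝ)) (𝓝 0) := (continuous_id.tendsto 0).mono_left nhdsWithin_le_nhds
  have h2 : Tendsto (fun g' : ℝ => Λ k (Fin.last k) * |g - g'|) (𝓝[>] (0 : ℝ)) (𝓝 (Λ k (Fin.last k) * |g - 0|)) :=
    tendsto_const_nhds.mul (tendsto_const_nhds.sub h0).abs
  have h := le_of_tendsto_of_tendsto h1 h2 hev
  rwa [sub_zero, abs_of_pos hg.1] at h

/-- **TWO FAMILIES AGREEING ON THE BOXES HAVE THE SAME ONE-LOOP NUMBERS** at admissible reference histories (`beta0OfMerged` is a `limUnder` along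
`𝓝[>] 0`, and the two last-coupling sections agree on `Ioc 0 γ ∈ 𝓝[>] 0`). [folklore] -/
theorem beta0OfMerged_congr_box {β β' : HBeta} (h : ∀ k (v : Fin (k + 1) → ℝ), v ∈ Box γ k → β k v = β' k v)
    {v₀ : (k : ℕ) → (Fin (k + 1) → ℝ)} (hv₀ : ∀ k i, 0 < v₀ k i ∧ v₀ k i ≤ γ) (k : ℕ) :
    beta0OfMerged β v₀ k = beta0OfMerged β' v₀ k := by
  have hγ : 0 < γ := (hv₀ k (Fin.last k)).1.trans_le (hv₀ k (Fin.last k)).2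
  have hev : (fun g : ℝ => β k (Function.update (v₀ k) (Fin.last k) g)) =ᶠ[𝓝[>] (0 : ℝ)]
      (fun g : ℝ => β' k (Function.update (v₀ k) (Fin.last k) g)) := by
    filter_upwards [Ioc_mem_nhdsGT hγ] with g hg
    exact h k _ (update_last_mem_box (mem_box.2 (hv₀ k)) hg)
  unfold beta0OfMerged limUnder
  rw [Filter.map_congr hev]

/-- **… AND CARRY THE SAME (2.12) CLAUSE** (`Filter.tendsto_congr'`). [folklore] -/
theorem beta0LimitExists_congr_box {β β' : HBeta} (h : ∀ k (v : Fin (k + 1) → ℝ), v ∈ Box γ k → β k v = β' k v)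
    {v₀ : (k : ℕ) → (Fin (k + 1) → ℝ)} (hv₀ : ∀ k i, 0 < v₀ k i ∧ v₀ k i ≤ γ) :
    Beta0LimitExists β v₀ ↔ Beta0LimitExists β' v₀ := by
  refine forall_congr' fun k => exists_congr fun b => Filter.tendsto_congr' ?_
  have hγ : 0 < γ := (hv₀ k (Fin.last k)).1.trans_le (hv₀ k (Fin.last k)).2
  filter_upwards [Ioc_mem_nhdsGT hγ] with g hg
  exact h k _ (update_last_mem_box (mem_box.2 (hv₀ k)) hg)

/-- **THE β OF RECORD'S SHAPE `betaOfMerged β_m β0 γ` AND `β_m` CARRY THE SAME CLAUSE** at admissible reference histories (on the boxes the former IS the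
latter, `Node00.betaOfMerged_of_mem`) — so the clause for a datum whose `βfun` is `betaOfMerged β_m … γ` is the clause for `β_m` the N17 consumers display.
[cite: Balaban1987RG1, (1.22) p.264 (bookkeeping)] -/
theorem beta0LimitExists_betaOfMerged_iff (βm : HBeta) (β0 : ℕ → ℝ) {v₀ : (k : ℕ) → (Fin (k + 1) → ℝ)}
    (hv₀ : ∀ k i, 0 < v₀ k i ∧ v₀ k i ≤ γ) :
    Beta0LimitExists (betaOfMerged βm β0 γ) v₀ ↔ Beta0LimitExists βm v₀ :=
  beta0LimitExists_congr_box (fun _ _ hv => betaOfMerged_of_mem βm β0 γ hv) hv₀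

end U2

/-! ## §3 Generic term family at def-W1's kernel objects: kernel NE9 + one (5.10) clause ⇒ the clause for the merged β (N18 idle) -/

section Kernels

variable {𝔄 : Type*} [NormedRing 𝔄] [NormedAlgebra ℝ 𝔄]
variable {V : Type*} [NormedAddCommGroup V] [NormedSpace ℝ V] {ι : Type*} [Fintype ι]
variable (F : T4Family) (ℰ : TermFamily1 F 𝔄) (ρ : V →L[ℝ] 𝔄) (bV : Module.Basis ι ℝ V)

/-- ★ **THE (2.12) CLAUSE FOR THE MERGED β OF A TERM FAMILY FROM KERNEL NE9 + ONE (5.10) CLAUSE** (dag-n22-w3's `histLipschitz_betaMerged_of_ne9` ∘ §2):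
`0 < κ`, `NE9 (EA F ℰ ρ bV) (Window γ) κ Λ`, `KernelDecay F ℰ ρ bV (Window γ) 0 1 κ`, admissible `v₀` ⟹ `Beta0LimitExists (betaMerged F ℰ ρ bV) v₀`.  LOCATED:
both kernel inputs displayed (N22's ∕ (D4)'s content), N18's NE5 idle. [cite: Balaban1987RG1, (1.20)-(1.22) p.264 and (5.10) p.293] -/
theorem beta0LimitExists_betaMerged_of_ne9 {γ κ : ℝ} {Λ : ℕ → ℕ → ℝ} (hκ : 0 < κ) (h9 : NE9 (EA F ℰ ρ bV) (Window γ) κ Λ)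
    (hdec : KernelDecay F ℰ ρ bV (Window γ) 0 1 κ) {v₀ : (k : ℕ) → (Fin (k + 1) → ℝ)} (hv₀ : ∀ k i, 0 < v₀ k i ∧ v₀ k i ≤ γ) :
    Beta0LimitExists (betaMerged F ℰ ρ bV) v₀ :=
  beta0LimitExists_of_histLipschitz (histLipschitz_betaMerged_of_ne9 F ℰ ρ bV hκ h9 hdec) hv₀

/-- **… WITH THE RATE AT THE FACE** `betaPrime510 4 1 κ · Λ (k+1) k · g` (node U2's modulus of the last coupling = the read-out constant times node U3's
modulus `Λ (k+1) k`). [cite: Balaban1987RG1, (1.20)-(1.22) p.264 and §5 p.298] -/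
theorem abs_betaMerged_sub_beta0OfMerged_le_of_ne9 {γ κ : ℝ} {Λ : ℕ → ℕ → ℝ} (hκ : 0 < κ) (h9 : NE9 (EA F ℰ ρ bV) (Window γ) κ Λ)
    (hdec : KernelDecay F ℰ ρ bV (Window γ) 0 1 κ) {v₀ : (k : ℕ) → (Fin (k + 1) → ℝ)} (hv₀ : ∀ k i, 0 < v₀ k i ∧ v₀ k i ≤ γ)
    (k : ℕ) {g : ℝ} (hg : g ∈ Set.Ioc 0 γ) :
    |betaMerged F ℰ ρ bV k (Function.update (v₀ k) (Fin.last k) g) - beta0OfMerged (betaMerged F ℰ ρ bV) v₀ k| ≤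
      betaPrime510 4 1 κ * Λ (k + 1) k * g := by
  have h := abs_sub_beta0OfMerged_le_of_histLipschitz (histLipschitz_betaMerged_of_ne9 F ℰ ρ bV hκ h9 hdec) hv₀ k hg
  rwa [Fin.val_last] at h

end Kernels

/-! ## §4 At the record, Stage 13: the consumers' `hlim` from the two raw kernel inputs K3⁷ v5 §2b (i)∕(iii) display -/

section Record

open scoped Matrix.Norms.L2Operator

variable (F : T4Family) (N : ℕ) [NeZero N]

/-- ★★ **THE CONSUMERS' `hlim` AT THE STAGE-13 RECORD FROM N22's KERNEL NE9 + (D4)'s (5.10) CLAUSE OF RECORD** (N18 idle): for a Stage-13 parameter `θ`,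
a letter block `ℓ`, `0 < κ`, kernel-currency NE9 of the functional of record on the window (`(objectsOfRecord₁₃ F N θ ℓ).EA 0` — VERBATIM K3⁷ v5 §2b (i)'s
`h9`), the (5.10) clause of record `KernelDecayOfRecord₁₃ F N θ 0 1 κ` (VERBATIM §2b (iii)'s `hdec`) and ADMISSIBLE reference histories `θ.v₀` (the
consumers' `hadm` at `γ' := θ.γ`):
`Beta0LimitExists (betaMerged F (mergedTermFamilyMatT F N (TcanOfRecord F N) (chiβOfRecord₁₃ F N θ) θ.εbg) θ.ρ8 θ.bV) θ.v₀` — VERBATIM the `hlim` of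
`…N17AtRecord13Sep.content_of_N17_datumOfRecord₁₃Sep` ∕ `…CoP` ∕ `…N13WindowAtRecord13SepCoPH` (`TβOfRecord₁₃ F N = TcanOfRecord F N` is an `abbrev`).
LOCATED: both kernel inputs and `hadm` displayed; nothing of the record is claimed to meet them. [cite: Balaban1987RG1, (1.20)-(1.22) p.264, (2.12)-(2.14) p.268 and (5.10) p.293] -/
theorem beta0LimitExists_betaMerged_record_of_kernelNE9 (θ : Stage13Params F N) (ℓ : U3Letters₁₁) {κ : ℝ} {Λ : ℕ → ℕ → ℝ} (hκ : 0 < κ)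
    (h9 : NE9 ((objectsOfRecord₁₃ F N θ ℓ).EA 0) (Window θ.γ) κ Λ) (hdec : KernelDecayOfRecord₁₃ F N θ 0 1 κ)
    (hadm : ∀ k i, 0 < θ.v₀ k i ∧ θ.v₀ k i ≤ θ.γ) :
    letI := θ.instVβ₁; letI := θ.instVβ₂; letI := θ.instιβ
    Beta0LimitExists (betaMerged F (mergedTermFamilyMatT F N (TcanOfRecord F N) (chiβOfRecord₁₃ F N θ) θ.εbg) θ.ρ8 θ.bV) θ.v₀ := by
  letI := θ.instVβ₁; letI := θ.instVβ₂; letI := θ.instιβ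
  exact beta0LimitExists_of_histLipschitz (histLipschitz_betaMerged_of_ne9 F _ θ.ρ8 θ.bV hκ h9 hdec) hadm

/-- **… WITH THE RATE AT THE FACE** at the record: `|β_m k (update (θ.v₀ k) last g) − β⁰_k| ≤ betaPrime510 4 1 κ · Λ (k+1) k · g` on `]0, θ.γ]`.
[cite: Balaban1987RG1, (1.20)-(1.22) p.264 and (2.12)-(2.14) p.268] -/
theorem abs_betaMerged_sub_beta0OfMerged_record_le_of_kernelNE9 (θ : Stage13Params F N) (ℓ : U3Letters₁₁) {κ : ℝ} {Λ : ℕ → ℕ → ℝ} (hκ : 0 < κ)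
    (h9 : NE9 ((objectsOfRecord₁₃ F N θ ℓ).EA 0) (Window θ.γ) κ Λ) (hdec : KernelDecayOfRecord₁₃ F N θ 0 1 κ)
    (hadm : ∀ k i, 0 < θ.v₀ k i ∧ θ.v₀ k i ≤ θ.γ) (k : ℕ) {g : ℝ} (hg : g ∈ Set.Ioc 0 θ.γ) :
    letI := θ.instVβ₁; letI := θ.instVβ₂; letI := θ.instιβ
    |betaMerged F (mergedTermFamilyMatT F N (TcanOfRecord F N) (chiβOfRecord₁₃ F N θ) θ.εbg) θ.ρ8 θ.bV k (Function.update (θ.v₀ k) (Fin.last k) g) -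
        beta0OfMerged (betaMerged F (mergedTermFamilyMatT F N (TcanOfRecord F N) (chiβOfRecord₁₃ F N θ) θ.εbg) θ.ρ8 θ.bV) θ.v₀ k| ≤
      betaPrime510 4 1 κ * Λ (k + 1) k * g := by
  letI := θ.instVβ₁; letI := θ.instVβ₂; letI := θ.instιβ
  exact abs_betaMerged_sub_beta0OfMerged_le_of_ne9 F _ θ.ρ8 θ.bV hκ h9 hdec hadm k hg

/-- **THE SAME FOR THE β OF RECORD ITSELF** (`betaOfRecord₁₃ F N θ = betaOfMerged β_m (beta0OfMerged β_m θ.v₀) θ.γ`, `rfl`; §2's box congruence):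
`Beta0LimitExists (betaOfRecord₁₃ F N θ) θ.v₀`. [cite: Balaban1987RG1, (1.20)-(1.22) p.264 and (2.12)-(2.14) p.268] -/
theorem beta0LimitExists_betaOfRecord₁₃_of_kernelNE9 (θ : Stage13Params F N) (ℓ : U3Letters₁₁) {κ : ℝ} {Λ : ℕ → ℕ → ℝ} (hκ : 0 < κ)
    (h9 : NE9 ((objectsOfRecord₁₃ F N θ ℓ).EA 0) (Window θ.γ) κ Λ) (hdec : KernelDecayOfRecord₁₃ F N θ 0 1 κ)
    (hadm : ∀ k i, 0 < θ.v₀ k i ∧ θ.v₀ k i ≤ θ.γ) :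
    Beta0LimitExists (betaOfRecord₁₃ F N θ) θ.v₀ := by
  letI := θ.instVβ₁; letI := θ.instVβ₂; letI := θ.instιβ
  exact (beta0LimitExists_betaOfMerged_iff _ _ hadm).2 (beta0LimitExists_betaMerged_record_of_kernelNE9 F N θ ℓ hκ h9 hdec hadm)

/-- **LETTER-BLOCK EDITION** (the K3⁷ v5 pin reads a letter block `ℓ : U3Letters₁₁` with N22's moduli `ℓ.moduli k i = ℓ.C₉·ℓ.ω^{k−i}`): with `0 < ℓ.κ`,
kernel NE9 at `(ℓ.κ, ℓ.moduli)` and the (5.10) clause at `ℓ.κ`, the clause holds AND the face is approached at the rate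
`betaPrime510 4 1 ℓ.κ · ℓ.C₉ · ℓ.ω · g`, UNIFORM IN `k` (`ℓ.moduli (k+1) k = ℓ.C₉·ℓ.ω`).  LOCATED. [cite: Balaban1987RG1, (1.20)-(1.22) p.264, §5 p.298 and (5.10) p.293] -/
theorem beta0LimitExists_betaMerged_record_of_kernelNE9_letters (θ : Stage13Params F N) (ℓ : U3Letters₁₁) (hκ : 0 < ℓ.κ)
    (h9 : NE9 ((objectsOfRecord₁₃ F N θ ℓ).EA 0) (Window θ.γ) ℓ.κ ℓ.moduli) (hdec : KernelDecayOfRecord₁₃ F N θ 0 1 ℓ.κ)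
    (hadm : ∀ k i, 0 < θ.v₀ k i ∧ θ.v₀ k i ≤ θ.γ) :
    letI := θ.instVβ₁; letI := θ.instVβ₂; letI := θ.instιβ
    Beta0LimitExists (betaMerged F (mergedTermFamilyMatT F N (TcanOfRecord F N) (chiβOfRecord₁₃ F N θ) θ.εbg) θ.ρ8 θ.bV) θ.v₀ ∧
      ∀ (k : ℕ) (g : ℝ), g ∈ Set.Ioc 0 θ.γ →
        |betaMerged F (mergedTermFamilyMatT F N (TcanOfRecord F N) (chiβOfRecord₁₃ F N θ) θ.εbg) θ.ρ8 θ.bV k (Function.update (θ.v₀ k) (Fin.last k) g) -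
            beta0OfMerged (betaMerged F (mergedTermFamilyMatT F N (TcanOfRecord F N) (chiβOfRecord₁₃ F N θ) θ.εbg) θ.ρ8 θ.bV) θ.v₀ k| ≤
          betaPrime510 4 1 ℓ.κ * ℓ.C₉ * ℓ.ω * g := by
  letI := θ.instVβ₁; letI := θ.instVβ₂; letI := θ.instιβ
  refine ⟨beta0LimitExists_betaMerged_record_of_kernelNE9 F N θ ℓ hκ h9 hdec hadm, fun k g hg => ?_⟩
  have h := abs_betaMerged_sub_beta0OfMerged_record_le_of_kernelNE9 F N θ ℓ hκ h9 hdec hadm k hg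
  rw [U3Letters₁₁.moduli_apply, Nat.add_sub_cancel_left, pow_one] at h
  simpa only [mul_assoc] using h

end Record

/-! ## §5 K3⁷ ∕ K4 currency: `ReadOutAt D u ∧ N22At u` at ANY node-U3 carriers ⇒ the clause for the datum's β (N18 idle); at the bundle of record -/

section Carriers

open scoped Matrix.Norms.L2Operator

variable {N : ℕ} [NeZero N] {F : T4Family}

/-- ★★ **THE (2.12) CLAUSE FOR THE DATUM's β ⇐ (D4) ∧ NE9 AT NODE U3's CARRIERS — N18 IDLE** (dag-n17-w3's `histLipschitz_of_readOutAt_ne9` ∘ §2): from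
`ReadOutAt D u` (only the window clause, run A's `RepresentsA`, the run-A slice membership and the read-out bound are used) and `NE9 u.EA u.W u.κ u.Λ`,
`Beta0LimitExists D.βfun v₀` at every reference-history family admissible in `]0, u.γ]`.  (D4) ∕ NE9 UNPRINTED — binders.
[cite: Balaban1987RG1, (1.20)-(1.22) p.264, (2.12)-(2.14) p.268 and §5 p.298] -/
theorem beta0LimitExists_βfun_of_readOutAt_ne9 (D : Datum F N) {u : U3Carriers} (hD4 : ReadOutAt D u) (h9 : NE9 u.EA u.W u.κ u.Λ)
    {v₀ : (k : ℕ) → (Fin (k + 1) → ℝ)} (hv₀ : ∀ k i, 0 < v₀ k i ∧ v₀ k i ≤ u.γ) : Beta0LimitExists D.βfun v₀ :=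
  beta0LimitExists_of_histLipschitz (histLipschitz_of_readOutAt_ne9 D hD4 h9) hv₀

/-- ★★ **… ⇐ (D4) ∧ N22** (the fading-memory half of `N22At` is idle). [cite: Balaban1987RG1, (2.12)-(2.14) p.268 and §5 p.298] -/
theorem beta0LimitExists_βfun_of_readOutAt_n22 (D : Datum F N) {u : U3Carriers} (hD4 : ReadOutAt D u) (h22 : N22At u)
    {v₀ : (k : ℕ) → (Fin (k + 1) → ℝ)} (hv₀ : ∀ k i, 0 < v₀ k i ∧ v₀ k i ≤ u.γ) : Beta0LimitExists D.βfun v₀ :=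
  beta0LimitExists_βfun_of_readOutAt_ne9 D hD4 h22.1 hv₀

/-- **… WITH THE RATE AT THE FACE** `u.cr · u.Λ (k+1) k · g` on `]0, u.γ]`. [cite: Balaban1987RG1, (2.12)-(2.14) p.268 and §5 p.298] -/
theorem abs_βfun_sub_beta0OfMerged_le_of_readOutAt_n22 (D : Datum F N) {u : U3Carriers} (hD4 : ReadOutAt D u) (h22 : N22At u)
    {v₀ : (k : ℕ) → (Fin (k + 1) → ℝ)} (hv₀ : ∀ k i, 0 < v₀ k i ∧ v₀ k i ≤ u.γ) (k : ℕ) {g : ℝ} (hg : g ∈ Set.Ioc 0 u.γ) :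
    |D.βfun k (Function.update (v₀ k) (Fin.last k) g) - beta0OfMerged D.βfun v₀ k| ≤ u.cr * u.Λ (k + 1) k * g := by
  have h := abs_sub_beta0OfMerged_le_of_histLipschitz (histLipschitz_of_readOutAt_n22 D hD4 h22) hv₀ k hg
  rwa [Fin.val_last] at h

/-- ★★ **AT THE BUNDLE OF RECORD OF ANY STAGE-13 RATE READING** (K3⁷ v5's `rrOfRecord 𝔯 ksel` at ONE tuple `(F, θ, hP, g₀, os)` and ONE run length `k`;
`PHolderD4 β D R` contains `ReadOutAt D R.u3` and, inside `RatesHolderAt`, `N22At R.u3`): the N22 and (D4) conjuncts at the node-U3 bundle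
`(rateCarriersOfRecord₁₃CoPH 𝔯 F θ hP g₀ os k).u3` (whose window radius IS `θ.γ`, `rfl`) ALREADY GIVE the consumers' `hlim` for the merged β of record at
every ADMISSIBLE `θ.v₀` — the datum's `βfun` is `betaOfRecord₁₃ F N θ` (`rfl`), which IS the merged β on the boxes (§2).  So under stub 1's body the
(2.12) clause is NOT an extra letter.  LOCATED: `ReadOutAt` ∕ `N22At` at the bundle are K3⁷'s conjuncts, displayed; `hadm` displayed; `stub_rates13H` NOT proved.
[cite: Balaban1987RG1, (1.20)-(1.22) p.264, (2.12)-(2.14) p.268 and §5 p.298] -/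
theorem beta0LimitExists_betaMerged_of_readOutAt_n22_rateCarriersOfRecord₁₃CoPH (𝔯 : RateReading₁₃CoPH N) (θ : Stage13HParams F N)
    (hP : θ.Provisos₁₃CoPH F N) (g₀ : ℕ → ℝ) (os : List (ULoop F)) (k : ℕ)
    (hD4 : ReadOutAt (datumOfRecord₁₃CoPH F N θ hP) (rateCarriersOfRecord₁₃CoPH 𝔯 F θ hP g₀ os k).u3)
    (h22 : N22At (rateCarriersOfRecord₁₃CoPH 𝔯 F θ hP g₀ os k).u3) (hadm : ∀ j i, 0 < θ.v₀ j i ∧ θ.v₀ j i ≤ θ.γ) :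
    letI := θ.instVβ₁; letI := θ.instVβ₂; letI := θ.instιβ
    Beta0LimitExists (betaMerged F (mergedTermFamilyMatT F N (TcanOfRecord F N) (chiβOfRecord₁₃ F N θ.toStage13Params) θ.εbg) θ.ρ8 θ.bV) θ.v₀ := by
  letI := θ.instVβ₁; letI := θ.instVβ₂; letI := θ.instιβ
  have h := beta0LimitExists_βfun_of_readOutAt_n22 (datumOfRecord₁₃CoPH F N θ hP) hD4 h22 (v₀ := θ.v₀) hadm
  exact (beta0LimitExists_betaOfMerged_iff _ _ hadm).1 h

/-- **… AND FOR THE β OF RECORD ITSELF** at that bundle: `Beta0LimitExists (betaOfRecord₁₃ F N θ.toStage13Params) θ.v₀`.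
[cite: Balaban1987RG1, (1.20)-(1.22) p.264 and (2.12)-(2.14) p.268] -/
theorem beta0LimitExists_betaOfRecord₁₃_of_readOutAt_n22_rateCarriersOfRecord₁₃CoPH (𝔯 : RateReading₁₃CoPH N) (θ : Stage13HParams F N)
    (hP : θ.Provisos₁₃CoPH F N) (g₀ : ℕ → ℝ) (os : List (ULoop F)) (k : ℕ)
    (hD4 : ReadOutAt (datumOfRecord₁₃CoPH F N θ hP) (rateCarriersOfRecord₁₃CoPH 𝔯 F θ hP g₀ os k).u3)
    (h22 : N22At (rateCarriersOfRecord₁₃CoPH 𝔯 F θ hP g₀ os k).u3) (hadm : ∀ j i, 0 < θ.v₀ j i ∧ θ.v₀ j i ≤ θ.γ) :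
    Beta0LimitExists (betaOfRecord₁₃ F N θ.toStage13Params) θ.v₀ :=
  beta0LimitExists_βfun_of_readOutAt_n22 (datumOfRecord₁₃CoPH F N θ hP) hD4 h22 (v₀ := θ.v₀) hadm

end Carriers

/-! ## §6 Served by name: K1⁷ ∕ K2⁷'s `K ≥ 1` window at the Sep datum and K2⁷ line 2's `k = 0` rung from the same two kernel inputs -/

section Served

open scoped Matrix.Norms.L2Operator
open Summit.QuantumFields.YangMills.Theorems.BalabanUVNodesN13WindowAtRecord13SepCoPH (window_datumOfRecord₁₃SepCoPH_of_beta0LimitExists)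
open Summit.QuantumFields.YangMills.Theorems.BalabanUVNodesK2Line2FirstRungsAtScaleZero (anchorZero_of_beta0LimitExists)

variable (F : T4Family) (N : ℕ) [NeZero N]

/-- **THE `K ≥ 1` WINDOW AT THE SEP DATUM OF RECORD FROM THE TWO KERNEL INPUTS** (dag-n13-w4's `window_datumOfRecord₁₃SepCoPH_of_beta0LimitExists` ∘ §4; only the
`k = 0` instance of the clause is read there): K1⁷ v6 rung 2's last conjunct ∕ K2⁷'s window hypothesis at `(θ, h)`.  LOCATED: kernel inputs + `hadm` displayed;
no K1⁷ ∕ K2⁷ stub is proved or claimed. [cite: Balaban1987RG1, (1.22) p.264 and (2.12)-(2.14) p.268; Balaban1989LargeFieldII, Thm 1 + (0.1) pp.355-356 (bookkeeping)] -/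
theorem window_datumOfRecord₁₃SepCoPH_of_kernelNE9 (θ : Stage13HParams F N) (h : θ.Provisos₁₃SepCoPH F N) (ℓ : U3Letters₁₁) {κ : ℝ} {Λ : ℕ → ℕ → ℝ}
    (hκ : 0 < κ) (h9 : NE9 ((objectsOfRecord₁₃ F N θ.toStage13Params ℓ).EA 0) (Window θ.γ) κ Λ)
    (hdec : KernelDecayOfRecord₁₃ F N θ.toStage13Params 0 1 κ) (hadm : ∀ k i, 0 < θ.v₀ k i ∧ θ.v₀ k i ≤ θ.γ) :
    ∃ γ₁ : ℝ, 0 < γ₁ ∧ ∀ γ : ℝ, 0 < γ → γ ≤ γ₁ →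
      ∃ P : B12.RunParams, 1 ≤ P.K ∧ ((Node00.datumOfRecord₁₃SepCoPH F N θ h).C P).flow.InInterval γ P.K :=
  window_datumOfRecord₁₃SepCoPH_of_beta0LimitExists θ h (beta0LimitExists_betaMerged_record_of_kernelNE9 F N θ.toStage13Params ℓ hκ h9 hdec hadm)

/-- **K2⁷ LINE 2's `k = 0` RUNG S2 (ANCHOR₀) FROM THE TWO KERNEL INPUTS** (dag-n13-w4's `anchorZero_of_beta0LimitExists` ∘ §4).  SERVED BY NAME, not claimed;
LOCATED. [cite: Balaban1987RG1, (2.12)-(2.14) p.268 and (1.22) p.264 (elementary)] -/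
theorem anchorZero_of_kernelNE9 (θ : Stage13HParams F N) (ℓ : U3Letters₁₁) {κ : ℝ} {Λ : ℕ → ℕ → ℝ} (hκ : 0 < κ)
    (h9 : NE9 ((objectsOfRecord₁₃ F N θ.toStage13Params ℓ).EA 0) (Window θ.γ) κ Λ) (hdec : KernelDecayOfRecord₁₃ F N θ.toStage13Params 0 1 κ)
    (hadm : ∀ k i, 0 < θ.v₀ k i ∧ θ.v₀ k i ≤ θ.γ) :
    letI := θ.instVβ₁; letI := θ.instVβ₂; letI := θ.instιβ
    ∀ δ : ℝ, 0 < δ → ∃ γ : ℝ, 0 < γ ∧ ∀ v ∈ Box γ 0,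
      |(Node00.oneLoopSplit_betaOfMerged (betaMerged F (mergedTermFamilyMatT F N (TcanOfRecord F N) (Node00.chiFixed29 F N θ.ν θ.ε₂₉) θ.εbg) θ.ρ8 θ.bV)
          (beta0OfMerged (betaMerged F (mergedTermFamilyMatT F N (TcanOfRecord F N) (Node00.chiFixed29 F N θ.ν θ.ε₂₉) θ.εbg) θ.ρ8 θ.bV) θ.v₀) θ.γ).β1 0 v| ≤ δ :=
  anchorZero_of_beta0LimitExists θ (beta0LimitExists_betaMerged_record_of_kernelNE9 F N θ.toStage13Params ℓ hκ h9 hdec hadm)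

end Served

end YMDAG.N18.Beta0LimitOfKernelLetters

end
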